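import Mathlib
import Summits.ValiantsHypothesis.ValiantsHypothesis.Theorems.ElementaryWordLengthWordLengthQPStubLetterMachineAux

/-!
# Crux `WordLengthQP` (stmt-ValiantsHypothesis-6623), line `Sketch` (eps-order-ladder) —
stub `stub_letterMachine`

Cohn's standard form for `GE₂` / Allender–Wang 2016 (ECCC TR11-083) Theorem 14 ("no mesas"), in
the S-model: a non-zero constant row vector times a product of LETTERS (`E(ℓ) = !![1, ℓ; 0, 1]`
with `ℓ.totalDegree ≤ 1`, the swap `w = !![0, 1; 1, 0]`, invertible constant diagonal matrices
`D(d₁, d₂) = !![C d₁, 0; 0, C d₂]`) equals row `0` of `Q(L₁) ⋯ Q(Lₘ) · w ^ ε · D(d₁, d₂)` with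
`Q(L) = !![L, 1; 1, 0]`, every `Lᵢ` affine and every INTERIOR `Lᵢ` (`1 < i < m`) non-constant.
The proof is a left-to-right letter machine (the `2 × 2` identities, the list/degree
bookkeeping and the easy machine steps live in the `…StubLetterMachineAux` file): the normal
form is an invariant of row vectors, maintained letter by letter through explicit `2 × 2`
identities; a constant form `c` that would become interior is re-normalised away by
`Q b · Q 0 · Q a = Q (b + a)` and, for `c ≠ 0`, by
`Q b · Q c · Q a = Q (b + c⁻¹) · Q (-c² a - c) · D(-c⁻¹, c)`.
-/

-- `Summit.ValiantsHypothesis.ValiantsHypothesis.…` is the tree's mandated single-conjunct layout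
-- (Sub = Summit), so the duplicated namespace component is intended.
set_option linter.dupNamespace false

noncomputable section

open MvPolynomial

namespace Summit.ValiantsHypothesis.ValiantsHypothesis.Cruxes.WordLengthQP.EpsOrderLadder

/-! ### The letter machine: the re-normalising step, the fold, and the stub -/

/-- Machine step for an elementary letter `E(ℓ)` when `ε = 0`: `E(ℓ') = Q(ℓ') * w` appends a
form; if the previous last form is a constant `c` that would become interior, it is re-normalised
away (`c = 0`: `Q b * Q 0 * Q a = Q (b + a)`; `c ≠ 0`: `letterMachine_renorm`). [folklore] -/
theorem letterMachine_step_elem_zero {σ : Type} (ls : List (MvPolynomial σ ℂ)) (d₁ d₂ : ℂ)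
    (ℓ : MvPolynomial σ ℂ) (hd₁ : d₁ ≠ 0) (hd₂ : d₂ ≠ 0) (hℓ : ℓ.totalDegree ≤ 1)
    (hdeg : ∀ L ∈ ls, L.totalDegree ≤ 1)
    (hint : ∀ (pre suf : List (MvPolynomial σ ℂ)) (L : MvPolynomial σ ℂ),
      ls = pre ++ L :: suf → pre ≠ [] → suf ≠ [] → 0 < L.totalDegree) :
    ∃ (ls' : List (MvPolynomial σ ℂ)) (ε' : ℕ) (d₁' d₂' : ℂ), ε' ≤ 1 ∧ d₁' ≠ 0 ∧ d₂' ≠ 0 ∧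
      (∀ L ∈ ls', L.totalDegree ≤ 1) ∧
      (∀ (pre suf : List (MvPolynomial σ ℂ)) (L : MvPolynomial σ ℂ),
        ls' = pre ++ L :: suf → pre ≠ [] → suf ≠ [] → 0 < L.totalDegree) ∧
      Matrix.vecMul (Matrix.vecMul ![1, 0]
          ((ls.map fun L => !![L, 1; 1, 0]).prod *
            (!![0, 1; 1, 0] : Matrix (Fin 2) (Fin 2) (MvPolynomial σ ℂ)) ^ 0 *
            !![MvPolynomial.C d₁, 0; 0, MvPolynomial.C d₂]))
          !![1, ℓ; 0, 1] =
        Matrix.vecMul ![1, 0]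
          ((ls'.map fun L => !![L, 1; 1, 0]).prod *
            (!![0, 1; 1, 0] : Matrix (Fin 2) (Fin 2) (MvPolynomial σ ℂ)) ^ ε' *
            !![MvPolynomial.C d₁', 0; 0, MvPolynomial.C d₂']) := by
  obtain ⟨ℓ', hℓ', hDE⟩ := letterMachine_push_diag d₁ d₂ hd₂ ℓ hℓ
  -- appending `ℓ'` to any list of forms realises the product with `E ℓ`
  have hsnoc : ∀ ks : List (MvPolynomial σ ℂ),
      (ks.map fun L => !![L, 1; 1, 0]).prod *
            (!![0, 1; 1, 0] : Matrix (Fin 2) (Fin 2) (MvPolynomial σ ℂ)) ^ 0 *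
            !![MvPolynomial.C d₁, 0; 0, MvPolynomial.C d₂] * !![1, ℓ; 0, 1] =
        ((ks ++ [ℓ']).map fun L => !![L, 1; 1, 0]).prod *
            (!![0, 1; 1, 0] : Matrix (Fin 2) (Fin 2) (MvPolynomial σ ℂ)) ^ 1 *
            !![MvPolynomial.C d₁, 0; 0, MvPolynomial.C d₂] := by
    intro ks
    simp only [List.map_append, List.map_cons, List.map_nil, List.prod_append, List.prod_cons,
      List.prod_nil, mul_one, pow_zero, pow_one, Matrix.mul_assoc]
    rw [hDE, letterMachine_elem_mul]
  have hdeg' : ∀ L ∈ ls ++ [ℓ'], L.totalDegree ≤ 1 := by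
    intro L hL
    rw [List.mem_append, List.mem_singleton] at hL
    rcases hL with hL | rfl
    · exact hdeg L hL
    · exact hℓ'
  -- is the plain snoc already in normal form?
  by_cases hok : ∀ (pre suf : List (MvPolynomial σ ℂ)) (L : MvPolynomial σ ℂ),
      ls ++ [ℓ'] = pre ++ L :: suf → pre ≠ [] → suf ≠ [] → 0 < L.totalDegree
  · exact ⟨ls ++ [ℓ'], 1, d₁, d₂, le_rfl, hd₁, hd₂, hdeg', hok,
      by rw [Matrix.vecMul_vecMul, hsnoc]⟩
  -- otherwise `ls = ls₁ ++ [Lk, C c]` ends in a constant form that would become interior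
  obtain ⟨ls₁, Lk, c, rfl⟩ : ∃ (ls₁ : List (MvPolynomial σ ℂ)) (Lk : MvPolynomial σ ℂ) (c : ℂ),
      ls = ls₁ ++ [Lk] ++ [C c] := by
    rcases List.eq_nil_or_concat' ls with rfl | ⟨ls₀, Lm, rfl⟩
    · exact (hok (letterMachine_interior_of_length_le _ _ (by simp))).elim
    rcases List.eq_nil_or_concat' ls₀ with rfl | ⟨ls₁, Lk, rfl⟩
    · exact (hok (letterMachine_interior_of_length_le _ _ (by simp))).elim
    by_cases hLm : 0 < Lm.totalDegree
    · exact (hok ((letterMachine_interior_snoc_iff _ _ _).mpr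
        ((letterMachine_tail_snoc_iff _ _ _).mpr
          ⟨(letterMachine_interior_snoc_iff _ _ _).mp hint, fun _ => hLm⟩))).elim
    · exact ⟨ls₁, Lk, Lm.coeff 0, by rw [← totalDegree_eq_zero_iff_eq_C.mp (by omega)]⟩
  have htail := (letterMachine_tail_snoc_iff (fun L : MvPolynomial σ ℂ => 0 < L.totalDegree)
    ls₁ Lk).mp ((letterMachine_interior_snoc_iff _ _ _).mp hint)
  have hLk : Lk.totalDegree ≤ 1 := hdeg Lk (by simp)
  by_cases hc : c = 0
  · -- `Q Lk * Q 0 * Q ℓ' = Q (Lk + ℓ')`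
    subst hc
    refine ⟨ls₁ ++ [Lk + ℓ'], 1, d₁, d₂, le_rfl, hd₁, hd₂, ?_, ?_, ?_⟩
    · intro L hL
      rw [List.mem_append, List.mem_singleton] at hL
      rcases hL with hL | rfl
      · exact hdeg L (by simp [hL])
      · exact letterMachine_deg_add _ _ hLk hℓ'
    · exact (letterMachine_interior_snoc_iff _ _ _).mpr htail.1
    · rw [Matrix.vecMul_vecMul, hsnoc]
      refine congrArg (Matrix.vecMul ![1, 0]) ?_
      simp only [List.map_append, List.map_cons, List.map_nil, List.prod_append, List.prod_cons,
        List.prod_nil, mul_one, pow_one, Matrix.mul_assoc, C_0]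
      rw [letterMachine_cont_zero_cont]
  · -- `Q Lk * Q (C c) * Q ℓ' * w * D = Q (Lk + C c⁻¹) * Q (C (-c²) ℓ' - C c) * w * D'`
    have key : C c * C c⁻¹ = (1 : MvPolynomial σ ℂ) := by rw [← C_mul, mul_inv_cancel₀ hc, C_1]
    refine ⟨ls₁ ++ [Lk + C c⁻¹] ++ [C (-c ^ 2) * ℓ' + C (-c)], 1, c * d₁, -c⁻¹ * d₂, le_rfl,
      mul_ne_zero hc hd₁, mul_ne_zero (neg_ne_zero.mpr (inv_ne_zero hc)) hd₂, ?_, ?_, ?_⟩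
    · intro L hL
      simp only [List.mem_append, List.mem_singleton] at hL
      rcases hL with (hL | rfl) | rfl
      · exact hdeg L (by simp [hL])
      · exact letterMachine_deg_add _ _ hLk (letterMachine_deg_C _)
      · exact letterMachine_deg_add _ _ (letterMachine_deg_C_mul _ _ hℓ') (letterMachine_deg_C _)
    · exact (letterMachine_interior_snoc_iff _ _ _).mpr
        ((letterMachine_tail_snoc_iff _ _ _).mpr
          ⟨htail.1, fun hne => letterMachine_pos_add_C _ _ (htail.2 hne)⟩)
    · rw [Matrix.vecMul_vecMul, hsnoc]
      refine congrArg (Matrix.vecMul ![1, 0]) ?_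
      simp only [List.map_append, List.map_cons, List.map_nil, List.prod_append, List.prod_cons,
        List.prod_nil, mul_one, pow_one, Matrix.mul_assoc, C_mul]
      rw [letterMachine_renorm (C c) (C c⁻¹) (C (-c ^ 2)) (C (-c)) (C (-c⁻¹)) ℓ' Lk (C d₁) (C d₂)
        key (by rw [C_neg, C_pow]) (C_neg _ _) (C_neg _ _)]

/-- One machine step: every letter maps normal forms to normal forms. [folklore] -/
theorem letterMachine_step {σ : Type} (x : Matrix (Fin 2) (Fin 2) (MvPolynomial σ ℂ))
    (hx : (∃ ℓ : MvPolynomial σ ℂ, ℓ.totalDegree ≤ 1 ∧ x = !![1, ℓ; 0, 1]) ∨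
        x = !![0, 1; 1, 0] ∨
        (∃ d₁ d₂ : ℂ, d₁ ≠ 0 ∧ d₂ ≠ 0 ∧
          x = !![MvPolynomial.C d₁, 0; 0, MvPolynomial.C d₂]))
    (ls : List (MvPolynomial σ ℂ)) (ε : ℕ) (d₁ d₂ : ℂ) (hε : ε ≤ 1) (hd₁ : d₁ ≠ 0) (hd₂ : d₂ ≠ 0)
    (hdeg : ∀ L ∈ ls, L.totalDegree ≤ 1)
    (hint : ∀ (pre suf : List (MvPolynomial σ ℂ)) (L : MvPolynomial σ ℂ),
      ls = pre ++ L :: suf → pre ≠ [] → suf ≠ [] → 0 < L.totalDegree) :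
    ∃ (ls' : List (MvPolynomial σ ℂ)) (ε' : ℕ) (d₁' d₂' : ℂ), ε' ≤ 1 ∧ d₁' ≠ 0 ∧ d₂' ≠ 0 ∧
      (∀ L ∈ ls', L.totalDegree ≤ 1) ∧
      (∀ (pre suf : List (MvPolynomial σ ℂ)) (L : MvPolynomial σ ℂ),
        ls' = pre ++ L :: suf → pre ≠ [] → suf ≠ [] → 0 < L.totalDegree) ∧
      Matrix.vecMul (Matrix.vecMul ![1, 0]
          ((ls.map fun L => !![L, 1; 1, 0]).prod *
            (!![0, 1; 1, 0] : Matrix (Fin 2) (Fin 2) (MvPolynomial σ ℂ)) ^ ε *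
            !![MvPolynomial.C d₁, 0; 0, MvPolynomial.C d₂]))
          x =
        Matrix.vecMul ![1, 0]
          ((ls'.map fun L => !![L, 1; 1, 0]).prod *
            (!![0, 1; 1, 0] : Matrix (Fin 2) (Fin 2) (MvPolynomial σ ℂ)) ^ ε' *
            !![MvPolynomial.C d₁', 0; 0, MvPolynomial.C d₂']) := by
  rcases hx with ⟨ℓ, hℓ, rfl⟩ | rfl | ⟨e₁, e₂, he₁, he₂, rfl⟩
  · rcases (by omega : ε = 0 ∨ ε = 1) with rfl | rfl
    · exact letterMachine_step_elem_zero ls d₁ d₂ ℓ hd₁ hd₂ hℓ hdeg hint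
    · exact letterMachine_step_elem_one ls d₁ d₂ ℓ hd₁ hd₂ hℓ hdeg hint
  · exact letterMachine_step_swap ls ε d₁ d₂ hε hd₁ hd₂ hdeg hint
  · exact letterMachine_step_diag ls ε d₁ d₂ e₁ e₂ hε hd₁ hd₂ he₁ he₂ hdeg hint

/-- Running the machine over a whole letter word (induction from the left). [folklore] -/
theorem letterMachine_fold {σ : Type} (ws : List (Matrix (Fin 2) (Fin 2) (MvPolynomial σ ℂ)))
    (hws : ∀ x ∈ ws, (∃ ℓ : MvPolynomial σ ℂ, ℓ.totalDegree ≤ 1 ∧ x = !![1, ℓ; 0, 1]) ∨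
        x = !![0, 1; 1, 0] ∨
        (∃ d₁ d₂ : ℂ, d₁ ≠ 0 ∧ d₂ ≠ 0 ∧
          x = !![MvPolynomial.C d₁, 0; 0, MvPolynomial.C d₂]))
    (ls : List (MvPolynomial σ ℂ)) (ε : ℕ) (d₁ d₂ : ℂ) (hε : ε ≤ 1) (hd₁ : d₁ ≠ 0) (hd₂ : d₂ ≠ 0)
    (hdeg : ∀ L ∈ ls, L.totalDegree ≤ 1)
    (hint : ∀ (pre suf : List (MvPolynomial σ ℂ)) (L : MvPolynomial σ ℂ),
      ls = pre ++ L :: suf → pre ≠ [] → suf ≠ [] → 0 < L.totalDegree) :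
    ∃ (ls' : List (MvPolynomial σ ℂ)) (ε' : ℕ) (d₁' d₂' : ℂ), ε' ≤ 1 ∧ d₁' ≠ 0 ∧ d₂' ≠ 0 ∧
      (∀ L ∈ ls', L.totalDegree ≤ 1) ∧
      (∀ (pre suf : List (MvPolynomial σ ℂ)) (L : MvPolynomial σ ℂ),
        ls' = pre ++ L :: suf → pre ≠ [] → suf ≠ [] → 0 < L.totalDegree) ∧
      Matrix.vecMul (Matrix.vecMul ![1, 0]
          ((ls.map fun L => !![L, 1; 1, 0]).prod *
            (!![0, 1; 1, 0] : Matrix (Fin 2) (Fin 2) (MvPolynomial σ ℂ)) ^ ε *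
            !![MvPolynomial.C d₁, 0; 0, MvPolynomial.C d₂]))
          ws.prod =
        Matrix.vecMul ![1, 0]
          ((ls'.map fun L => !![L, 1; 1, 0]).prod *
            (!![0, 1; 1, 0] : Matrix (Fin 2) (Fin 2) (MvPolynomial σ ℂ)) ^ ε' *
            !![MvPolynomial.C d₁', 0; 0, MvPolynomial.C d₂']) := by
  induction ws generalizing ls ε d₁ d₂ with
  | nil =>
    exact ⟨ls, ε, d₁, d₂, hε, hd₁, hd₂, hdeg, hint, by rw [List.prod_nil, Matrix.vecMul_one]⟩
  | cons x ws ih =>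
    obtain ⟨ls₁, ε₁, a₁, b₁, hε₁, ha₁, hb₁, hdeg₁, hint₁, h₁⟩ :=
      letterMachine_step x (hws x List.mem_cons_self) ls ε d₁ d₂ hε hd₁ hd₂ hdeg hint
    obtain ⟨ls₂, ε₂, a₂, b₂, hε₂, ha₂, hb₂, hdeg₂, hint₂, h₂⟩ :=
      ih (fun y hy => hws y (List.mem_cons_of_mem x hy)) ls₁ ε₁ a₁ b₁ hε₁ ha₁ hb₁ hdeg₁ hint₁
    refine ⟨ls₂, ε₂, a₂, b₂, hε₂, ha₂, hb₂, hdeg₂, hint₂, ?_⟩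
    rw [List.prod_cons, ← Matrix.vecMul_vecMul, h₁, h₂]

/-! ### The stub -/

/-- **stub_letterMachine** (Cohn standard form / AW16 Thm 14, S-model): a non-zero constant row
vector times a product of letters equals row `0` of `(∏ᵢ !![Lᵢ, 1; 1, 0]) · w^ε · diag(d₁, d₂)` for
affine forms `Lᵢ` all of whose INTERIOR members (neither first nor last) are non-constant. -/
theorem stub_letterMachine {σ : Type} [Fintype σ] [DecidableEq σ]
    (ws : List (Matrix (Fin 2) (Fin 2) (MvPolynomial σ ℂ)))
    (hws : ∀ x ∈ ws, (∃ ℓ : MvPolynomial σ ℂ, ℓ.totalDegree ≤ 1 ∧ x = !![1, ℓ; 0, 1]) ∨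
        x = !![0, 1; 1, 0] ∨
        (∃ d₁ d₂ : ℂ, d₁ ≠ 0 ∧ d₂ ≠ 0 ∧
          x = !![MvPolynomial.C d₁, 0; 0, MvPolynomial.C d₂]))
    (r : Fin 2 → ℂ) (hr : r ≠ 0) :
    ∃ (ls : List (MvPolynomial σ ℂ)) (ε : ℕ) (d₁ d₂ : ℂ), d₁ ≠ 0 ∧ d₂ ≠ 0 ∧
      (∀ L ∈ ls, L.totalDegree ≤ 1) ∧
      (∀ (pre suf : List (MvPolynomial σ ℂ)) (L : MvPolynomial σ ℂ),
        ls = pre ++ L :: suf → pre ≠ [] → suf ≠ [] → 0 < L.totalDegree) ∧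
      Matrix.vecMul (fun i => MvPolynomial.C (r i)) ws.prod =
        Matrix.vecMul ![1, 0]
          ((ls.map (fun L => (!![L, 1; 1, 0] : Matrix (Fin 2) (Fin 2) (MvPolynomial σ ℂ)))).prod *
            (!![0, 1; 1, 0] : Matrix (Fin 2) (Fin 2) (MvPolynomial σ ℂ)) ^ ε *
            !![MvPolynomial.C d₁, 0; 0, MvPolynomial.C d₂]) := by
  -- the constant row vector itself is in normal form
  obtain ⟨ls, ε, d₁, d₂, hε, hd₁, hd₂, hdeg, hint, h0⟩ :
      ∃ (ls : List (MvPolynomial σ ℂ)) (ε : ℕ) (d₁ d₂ : ℂ), ε ≤ 1 ∧ d₁ ≠ 0 ∧ d₂ ≠ 0 ∧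
        (∀ L ∈ ls, L.totalDegree ≤ 1) ∧
        (∀ (pre suf : List (MvPolynomial σ ℂ)) (L : MvPolynomial σ ℂ),
          ls = pre ++ L :: suf → pre ≠ [] → suf ≠ [] → 0 < L.totalDegree) ∧
        (fun i => MvPolynomial.C (r i)) = Matrix.vecMul ![1, 0]
          ((ls.map fun L => !![L, 1; 1, 0]).prod *
            (!![0, 1; 1, 0] : Matrix (Fin 2) (Fin 2) (MvPolynomial σ ℂ)) ^ ε *
            !![MvPolynomial.C d₁, 0; 0, MvPolynomial.C d₂]) := by
    by_cases hr1 : r 1 = 0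
    · have hr0 : r 0 ≠ 0 := by
        intro hr0
        apply hr
        ext i
        fin_cases i
        · exact hr0
        · exact hr1
      refine ⟨[], 0, r 0, 1, zero_le_one, hr0, one_ne_zero, by simp,
        letterMachine_interior_of_length_le _ _ (by simp), ?_⟩
      funext i
      fin_cases i <;> simp [Matrix.vecMul, dotProduct, Fin.sum_univ_two, hr1]
    · have key : C (r 0 / r 1) * C (r 1) = (C (r 0) : MvPolynomial σ ℂ) := by
        rw [← C_mul, div_mul_cancel₀ _ hr1]
      refine ⟨[C (r 0 / r 1)], 0, r 1, r 1, zero_le_one, hr1, hr1, by simp [totalDegree_C],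
        letterMachine_interior_of_length_le _ _ (by simp), ?_⟩
      funext i
      fin_cases i <;>
        simp [Matrix.vecMul, dotProduct, Fin.sum_univ_two, Matrix.mul_apply, key]
  obtain ⟨ls', ε', d₁', d₂', -, hd₁', hd₂', hdeg', hint', h⟩ :=
    letterMachine_fold ws hws ls ε d₁ d₂ hε hd₁ hd₂ hdeg hint
  exact ⟨ls', ε', d₁', d₂', hd₁', hd₂', hdeg', hint', by rw [h0, h]⟩

end Summit.ValiantsHypothesis.ValiantsHypothesis.Cruxes.WordLengthQP.EpsOrderLadder
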